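import Literature.NumberTheory.PAdicHodge.BmaxPlusFormalLogDivisionTower
import Literature.NumberTheory.EllipticCurves.FormalLogHondaNumeratorsProofs
import HarnessLib

/-!
# The exact Frobenius relation `φ²Λ − a_p·φΛ + p·Λ = 0` in `A_max` for the periods of an elliptic curve with good reduction over `ℤ_p`

Topic `Literature/NumberTheory/PAdicHodge`; namespace `Literature.NumberTheory.PAdicHodge.AinfTop`. THEOREMS ONLY (no definition, no named
fact, no instance, no `sorry`). The SPECIALISATION `a = a_p = p + 1 − #W̃(𝔽_p)` of
`BmaxPlusFormalLogDivisionTower.frobBmaxPlus_honda_logSum_divisionLiftPt_eq_zero` (exact Dieudonné–Honda relation for the `A_max`-period of every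
`[p]_W`-division sequence, for `log_W` of ANY Honda type `p − aT + T²`): for an integral Weierstrass equation `W/ℤ` whose base change to `ℤ_p` has
elliptic generic AND special fibre (good reduction at `p`), Honda's congruences `m ∣ b_m − [p∣m]·a_p·b_{m/p} + [p²∣m]·p·b_{m/p²}`
(`EllipticCurves.exists_natCast_mul_eq_honda_numerator`, every prime `p`) supply the hypothesis `he` with `a = a_p`:

* `map_intCast_padicInt_map_coe`, `map_intCast_padicInt_map_toZMod` — `(W ⊗ ℤ_p) ⊗ ℚ_p = W ⊗ ℚ_p`, `(W ⊗ ℤ_p) ⊗ 𝔽_p = W ⊗ 𝔽_p`;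
* `coe_formalLogNum_eq` — the numerators `formalLogNum W p` ARE the `b_m = m·coeff_m log_{W ⊗ ℚ_p}` of the Honda file;
* ★★★★ `frobBmaxPlus_hondaTrace_logSum_divisionLiftPt_eq_zero` — **`φ²Λ − ι(a_p)·φΛ + p·Λ = 0` in `A_max`** for `Λ = Λ_N(ι[ũ], z)`, `u` ANY
  `[p]_W`-division sequence of points of `Ŵ(𝔪_{ℂ_F})`, `a_p = HasseManin.tr (W ⊗ 𝔽_p)`;
* ★★ `frobBmaxPlus_det_logSum_divisionLiftPt_of_isElliptic` — `φD = p·D` for the Legendre determinant of two division sequences.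

So for an elliptic curve with good reduction over `ℤ_p` (ordinary or supersingular) the `A_max`-periods `(L, M := φL)` of every element of the
universal cover of `Ŵ` satisfy `φ(L, M) = (L, M)·[[0, −p], [1, a_p]]` — Frobenius of the Dieudonné module of `W̃` (characteristic polynomial
`X² − a_pX + p`) read on periods, without crystalline cohomology (φ-road of line `kato_lever`, crux K★ `stmt-BirchSwinnertonDyer-22226`, memo
`Summits/…/Cruxes/StarredOptimalManinUnitFiveSeven/Lines/kato-lever-K2-phi-road.md` §2). Infrastructure only; BSD / K★ are not proved by any of this.

## References
* T. Honda, *On the theory of commutative formal groups*, J. Math. Soc. Japan 22 (1970), Thm. 2 (p. 223), Thm. 9. [Honda1970]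
* P. Colmez, *Périodes p-adiques des variétés abéliennes*, Math. Ann. 292 (1992), §2. [Colmez1992PeriodesAbeliennes]
* J. H. Silverman, *The Arithmetic of Elliptic Curves* (2009), IV.5.5, V.2. [SilvermanAEC2009]
-/

noncomputable section

open Ideal WittVector ValuativeRel Field

namespace Literature.NumberTheory.PAdicHodge

namespace AinfTop

open Literature.NumberTheory.GaloisRepresentations Literature.NumberTheory.GaloisRepresentations.IsNonarchimedeanLocalField
open Literature.NumberTheory.GaloisRepresentations.LubinTate Literature.NumberTheory.EllipticCurves
open Literature.RingTheory.FormalGroups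

/-! ## §1 Base changes of `W ⊗ ℤ_p` and the numerators -/

/-- `(W ⊗ ℤ_p) ⊗ ℚ_p = W ⊗ ℚ_p`. [cite: SilvermanAEC2009, IV.5.5] -/
theorem map_intCast_padicInt_map_coe {p : ℕ} [Fact p.Prime] (W : WeierstrassCurve ℤ) :
    (W.map (Int.castRingHom ℤ_[p])).map PadicInt.Coe.ringHom = W.map (Int.castRingHom ℚ_[p]) := by
  rw [WeierstrassCurve.map_map, RingHom.ext_int (PadicInt.Coe.ringHom.comp (Int.castRingHom ℤ_[p])) (Int.castRingHom ℚ_[p])]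

/-- `(W ⊗ ℤ_p) ⊗ 𝔽_p = W ⊗ 𝔽_p`. [cite: SilvermanAEC2009, IV.5.5] -/
theorem map_intCast_padicInt_map_toZMod {p : ℕ} [Fact p.Prime] (W : WeierstrassCurve ℤ) :
    (W.map (Int.castRingHom ℤ_[p])).map PadicInt.toZMod = W.map (Int.castRingHom (ZMod p)) := by
  rw [WeierstrassCurve.map_map, RingHom.ext_int (PadicInt.toZMod.comp (Int.castRingHom ℤ_[p])) (Int.castRingHom (ZMod p))]

/-- **The numerators `formalLogNum W p` are the `b_m = m · coeff_m log_{(W ⊗ ℤ_p) ⊗ ℚ_p}` of `FormalLogHondaNumeratorsProofs`** (hypothesis `hb` there).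
[cite: SilvermanAEC2009, IV.5.5] -/
theorem coe_formalLogNum_eq {p : ℕ} [Fact p.Prime] (W : WeierstrassCurve ℤ) (m : ℕ) :
    ((GaloisContinuity.formalLogNum W p m : ℤ_[p]) : ℚ_[p]) =
      (m : ℚ_[p]) * PowerSeries.coeff m ((W.map (Int.castRingHom ℤ_[p])).map PadicInt.Coe.ringHom).formalLog := by
  rw [map_intCast_padicInt_map_coe]; rfl

/-! ## §2 The exact relation with `a = a_p` -/

variable {F : Type} [Field F] [ValuativeRel F] [TopologicalSpace F] [IsNonarchimedeanLocalField F]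
  [CharZero F] {p : ℕ} [Fact p.Prime] [Fact (¬ IsUnit (p : integerC F))]
  [IsAdicComplete (Ideal.span {(p : integerC F)}) (integerC F)]
  {hθ : Function.Surjective (fontaineTheta (integerC F) p)} (W : WeierstrassCurve ℤ)

/-- **Honda's congruences for `W` with good reduction at `p`, in the form `he`** of `BmaxPlusFormalLogDivisionTower` (`b = formalLogNum W p`,
`a = a_p = HasseManin.tr (W ⊗ 𝔽_p)`). [cite: Honda1970, Thm. 9 (pp. 240–241)] -/
theorem exists_natCast_mul_eq_honda_formalLogNum [hE : (W.map (Int.castRingHom ℚ_[p])).IsElliptic]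
    [hEt : (W.map (Int.castRingHom (ZMod p))).IsElliptic] :
    ∃ e : ℕ → ℤ_[p], ∀ m : ℕ, m ≠ 0 → (m : ℤ_[p]) * e m =
      GaloisContinuity.formalLogNum W p m -
          (if p ∣ m then ((HasseManin.tr (W.map (Int.castRingHom (ZMod p))) : ℤ) : ℤ_[p]) * GaloisContinuity.formalLogNum W p (m / p)
            else 0) +
        (if p ^ 2 ∣ m then (p : ℤ_[p]) * GaloisContinuity.formalLogNum W p (m / p ^ 2) else 0) := by
  haveI : ((W.map (Int.castRingHom ℤ_[p])).map PadicInt.Coe.ringHom).IsElliptic := by rw [map_intCast_padicInt_map_coe]; exact hE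
  haveI : ((W.map (Int.castRingHom ℤ_[p])).map PadicInt.toZMod).IsElliptic := by rw [map_intCast_padicInt_map_toZMod]; exact hEt
  obtain ⟨e, he⟩ := exists_natCast_mul_eq_honda_numerator (W.map (Int.castRingHom ℤ_[p])) (GaloisContinuity.formalLogNum W p)
    (coe_formalLogNum_eq W)
  rw [map_intCast_padicInt_map_toZMod] at he
  exact ⟨e, he⟩

set_option maxHeartbeats 1600000 in
/-- ★★★★ **`φ²Λ − a_p·φΛ + p·Λ = 0` in `A_max` for an elliptic curve with good reduction over `ℤ_p`.** Let `W/ℤ` be an integral Weierstrass equation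
with `W ⊗ ℚ_p` and `W ⊗ 𝔽_p` elliptic, `a_p = p + 1 − #W̃(𝔽_p)` (`HasseManin.tr`), `u` ANY `[p]_W`-division sequence of points of `Ŵ(𝔪_{ℂ_F})`, `[ũ] ∈ Ŵ(𝔫)`
Fontaine's integral and `Λ = Λ_N(ι[ũ], z) = p^N·log_W(ι[ũ]) ∈ A_max = B_max⁺(F)` its period (`N ≥ 1`, any witness `ι[ũ]^N = p·z`). Then with
`φ = frobBmaxPlus`: **`φ²Λ − ι(a_p)·φΛ + p·Λ = 0`** (`frobBmaxPlus_honda_logSum_divisionLiftPt_eq_zero` with Honda's congruences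
`exists_natCast_mul_eq_honda_formalLogNum`). [cite: Honda1970, Thm. 2 (p. 223) and Thm. 9] [cite: Colmez1992PeriodesAbeliennes, §2] -/
theorem frobBmaxPlus_hondaTrace_logSum_divisionLiftPt_eq_zero [(W.map (Int.castRingHom ℚ_[p])).IsElliptic]
    [(W.map (Int.castRingHom (ZMod p))).IsElliptic]
    {u : ℕ → (maxNilIdealC F).toIdeal} (hup : ∀ n, mulPC F p W (u (n + 1)) = u n) {N : ℕ} (hN : 1 ≤ N) {z : bmaxZero F p}
    (hz : algebraMap (Ainf (p := p) F) (bmaxZero F p)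
        ((AinfTop.of F p).symm (((divisionLiftPt W hθ u hup).val : (nilTheta F p hθ).toIdeal) : AinfTop F p)) ^ N =
      (p : bmaxZero F p) * z) :
    frobBmaxPlus F p (frobBmaxPlus F p
        (PadicLogSeries.logSum ((algebraMap (Ainf (p := p) F) (bmaxZero F p)).comp zpToAinf) (GaloisContinuity.formalLogNum W p) N
          (algebraMap (Ainf (p := p) F) (bmaxZero F p)
            ((AinfTop.of F p).symm (((divisionLiftPt W hθ u hup).val : (nilTheta F p hθ).toIdeal) : AinfTop F p))) z)) -
      AdicCompletion.of (Ideal.span {(p : bmaxZero F p)}) (bmaxZero F p)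
          (((algebraMap (Ainf (p := p) F) (bmaxZero F p)).comp zpToAinf)
            ((HasseManin.tr (W.map (Int.castRingHom (ZMod p))) : ℤ) : ℤ_[p])) *
        frobBmaxPlus F p
          (PadicLogSeries.logSum ((algebraMap (Ainf (p := p) F) (bmaxZero F p)).comp zpToAinf) (GaloisContinuity.formalLogNum W p) N
            (algebraMap (Ainf (p := p) F) (bmaxZero F p)
              ((AinfTop.of F p).symm (((divisionLiftPt W hθ u hup).val : (nilTheta F p hθ).toIdeal) : AinfTop F p))) z) +
      AdicCompletion.of (Ideal.span {(p : bmaxZero F p)}) (bmaxZero F p) (p : bmaxZero F p) *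
        PadicLogSeries.logSum ((algebraMap (Ainf (p := p) F) (bmaxZero F p)).comp zpToAinf) (GaloisContinuity.formalLogNum W p) N
          (algebraMap (Ainf (p := p) F) (bmaxZero F p)
            ((AinfTop.of F p).symm (((divisionLiftPt W hθ u hup).val : (nilTheta F p hθ).toIdeal) : AinfTop F p))) z = 0 := by
  obtain ⟨e, he⟩ := exists_natCast_mul_eq_honda_formalLogNum (p := p) W
  exact frobBmaxPlus_honda_logSum_divisionLiftPt_eq_zero W (hθ := hθ) _ e he hup hN hz

set_option maxHeartbeats 1600000 in
/-- ★★ **`φD = p·D`** for the Legendre determinant `D = Λ·φΛ′ − φΛ·Λ′` of the periods of two `[p]_W`-division sequences of an elliptic curve with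
good reduction over `ℤ_p` (`frobBmaxPlus_det_logSum_divisionLiftPt` with Honda's congruences). [cite: Honda1970, Thm. 2 (p. 223)]
[cite: Colmez1992PeriodesAbeliennes, §2] -/
theorem frobBmaxPlus_det_logSum_divisionLiftPt_of_isElliptic [(W.map (Int.castRingHom ℚ_[p])).IsElliptic]
    [(W.map (Int.castRingHom (ZMod p))).IsElliptic]
    {u u' : ℕ → (maxNilIdealC F).toIdeal} (hup : ∀ n, mulPC F p W (u (n + 1)) = u n) (hup' : ∀ n, mulPC F p W (u' (n + 1)) = u' n)
    {N N' : ℕ} (hN : 1 ≤ N) (hN' : 1 ≤ N') {z z' : bmaxZero F p}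
    (hz : algebraMap (Ainf (p := p) F) (bmaxZero F p)
        ((AinfTop.of F p).symm (((divisionLiftPt W hθ u hup).val : (nilTheta F p hθ).toIdeal) : AinfTop F p)) ^ N =
      (p : bmaxZero F p) * z)
    (hz' : algebraMap (Ainf (p := p) F) (bmaxZero F p)
        ((AinfTop.of F p).symm (((divisionLiftPt W hθ u' hup').val : (nilTheta F p hθ).toIdeal) : AinfTop F p)) ^ N' =
      (p : bmaxZero F p) * z') :
    let Λ := PadicLogSeries.logSum ((algebraMap (Ainf (p := p) F) (bmaxZero F p)).comp zpToAinf) (GaloisContinuity.formalLogNum W p) N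
      (algebraMap (Ainf (p := p) F) (bmaxZero F p)
        ((AinfTop.of F p).symm (((divisionLiftPt W hθ u hup).val : (nilTheta F p hθ).toIdeal) : AinfTop F p))) z
    let Λ' := PadicLogSeries.logSum ((algebraMap (Ainf (p := p) F) (bmaxZero F p)).comp zpToAinf) (GaloisContinuity.formalLogNum W p) N'
      (algebraMap (Ainf (p := p) F) (bmaxZero F p)
        ((AinfTop.of F p).symm (((divisionLiftPt W hθ u' hup').val : (nilTheta F p hθ).toIdeal) : AinfTop F p))) z'
    frobBmaxPlus F p (Λ * frobBmaxPlus F p Λ' - frobBmaxPlus F p Λ * Λ') =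
      (p : BmaxPlus F p) * (Λ * frobBmaxPlus F p Λ' - frobBmaxPlus F p Λ * Λ') := by
  obtain ⟨e, he⟩ := exists_natCast_mul_eq_honda_formalLogNum (p := p) W
  exact frobBmaxPlus_det_logSum_divisionLiftPt W (hθ := hθ) _ e he hup hup' hN hN' hz hz'

end AinfTop

end Literature.NumberTheory.PAdicHodge

end
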